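/-
Copyright (c) 2026 the pub-hodgecm-mathlib formalisation cell (harness21).  Prover seat hodgecm-mathlib-K2Liu-p10 (g4), Track B «K2-LIT»,
#184♮ = hLiu418 = `stmt-HodgeConjecture-24832`; (σ) endgame organ, socket σ-1 of ★∕📤 I-4b `faceA4R_two_of_record`: the character `χ′_v` and its letter `hχ′`.
-/
import Literature.NumberTheory.Automorphic.UnitaryGroupAutomorphicRep   -- ★ `PlacesOver`, `galAdicCompletionMap`, `under_inv_smul_eq`
import HarnessLib

/-!
# Crux `HLiu418`, (σ) endgame, socket σ-1: THE CONJUGATE-INVERSE LOCAL CHARACTER FAMILY `χ′_w := (χ_{c w})⁻¹ ∘ gal_{w → c w}` AND V8e's LETTER `hχ′`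

Cell `hodgecm-mathlib`, crux item hLiu418 = `stmt-HodgeConjecture-24832`, route of record `HCCMUnconditional`; squad K2 ∕ K2Liu, prover K2Liu-p10 (g4).
ONE DEFINITION WITH BODY + theorems; no instance, no notation, no named fact, no `sorry`; definition lane, `--supports stmt-HodgeConjecture-24832 --as helper`.
Generic currency `(F E c v)` of ★ `UnitaryGroupAutomorphicRep`.

★ V8e `face_two_of_laws` ∕ 📤 I-4b `faceA4R_two_of_record` take `χv′` and `hχ′ : ∀ w w′ (h : c • w.1 = w′.1), χv′ w = (χv w′)⁻¹.comp (Units.map (galAdicCompletionMap c h))` BY VALUE;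
this file supplies the ONLY such family: **`conjInvChar c v χv w := (χv (c • w))⁻¹.comp (Units.map gal_{w → c•w})`** and proves **`conjInvChar_eq`** = `hχ′` verbatim
(the target place `w′` is forced to be `c • w`; `galAdicCompletionMap` does not depend on the proof of `c • w = w′`).

HONEST LABEL: HC_CM is proved only modulo the 7 printed citations (2 remaining named inputs: hLiu418 = stmt-HodgeConjecture-24832, h413 = stmt-HodgeConjecture-24833)
until rung 0 closes; this file defines one character family and closes no item.
References: [Liu2021] App. B §B.3 (`μᶜ`, the conjugate character inducing the degenerate principal series); [HarrisKudlaSweet1996] §1 (1.15).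
-/

set_option autoImplicit false
set_option linter.dupNamespace false -- the mandated namespace repeats `HodgeConjecture.HodgeConjecture`

noncomputable section

open NumberField IsDedekindDomain
open Literature.NumberTheory.Automorphic Literature.NumberTheory.Automorphic.UnitaryGroup

namespace Summit.HodgeConjecture.HodgeConjecture.Cruxes.HLiu418.K2LiuA7ValueSocketChi

variable {F : Type} [Field F] [NumberField F] (E : Type) [Field E] [NumberField E] [Algebra F E] (c : E ≃ₐ[F] E)
  (v : HeightOneSpectrum (𝓞 F))

/-- `c • w` lies over `v` when `w` does. [folklore] -/
theorem under_smul_eq (w : PlacesOver E v) : (c • w.1).under (𝓞 F) = v := by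
  rw [HeightOneSpectrum.under_smul]; exact w.2

/-- **THE CONJUGATE-INVERSE FAMILY `χ′_w := (χ_{c•w})⁻¹ ∘ gal_{w → c•w}`** (Liu's `μᶜ`-type twist of a local character family at the places over `v`).
[cite: Liu2021, App. B §B.3] [cite: HarrisKudlaSweet1996, §1 (1.15)] -/
def conjInvChar (χv : ∀ w : PlacesOver E v, (w.1.adicCompletion E)ˣ →* ℂˣ) (w : PlacesOver E v) : (w.1.adicCompletion E)ˣ →* ℂˣ :=
  (χv ⟨c • w.1, under_smul_eq E c v w⟩)⁻¹.comp
    (Units.map (galAdicCompletionMap (L := E) c (rfl : c • w.1 = c • w.1) : w.1.adicCompletion E →* (c • w.1).adicCompletion E))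

/-- unfolding at the forced target place. [cite: Liu2021, App. B §B.3] -/
theorem conjInvChar_apply (χv : ∀ w : PlacesOver E v, (w.1.adicCompletion E)ˣ →* ℂˣ) (w : PlacesOver E v) (z : (w.1.adicCompletion E)ˣ) :
    conjInvChar E c v χv w z = ((χv ⟨c • w.1, under_smul_eq E c v w⟩) (Units.map (galAdicCompletionMap (L := E) c (rfl : c • w.1 = c • w.1) :
      w.1.adicCompletion E →* (c • w.1).adicCompletion E) z))⁻¹ :=
  rfl

/-- **V8e's `hχ′` VERBATIM**: for every `w, w′` over `v` with `c • w = w′`, `χ′_w = (χ_{w′})⁻¹ ∘ gal_{w → w′}`. [cite: Liu2021, App. B §B.3] [cite: HarrisKudlaSweet1996, §1 (1.15)] -/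
theorem conjInvChar_eq (χv : ∀ w : PlacesOver E v, (w.1.adicCompletion E)ˣ →* ℂˣ) (w w' : PlacesOver E v) (h : c • w.1 = w'.1) :
    conjInvChar E c v χv w = (χv w')⁻¹.comp (Units.map (galAdicCompletionMap (L := E) c h : w.1.adicCompletion E →* w'.1.adicCompletion E)) := by
  obtain ⟨w'', hw''⟩ := w'
  simp only at h
  subst h
  rfl

end Summit.HodgeConjecture.HodgeConjecture.Cruxes.HLiu418.K2LiuA7ValueSocketChi

end
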